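import Literature.Geometry.Symplectic.SymplecticTraceHessianIntegral
import Literature.Geometry.GaugeTheory.ConnDerivEnergyIdentity
import HarnessLib

/-!
# The energy identity `∫(|∂̄_aα|² - |∂_aα|²) ω² = ∫ |α|² (F_a ∧ ω)`-type on a closed symplectic `4`-manifold

Topic `Literature/Geometry/Symplectic`; Hutchings–Taubes (4.18) / Taubes's "Bogomolny" rearrangement
(Taubes 1995, (5.5)): for a smooth complex function `α` and a smooth real 1-form `A` on the closed
symplectic `4`-manifold `(N, s, J)` (unitary connection `∇ = d + iA` on the trivial line bundle), with
`∇_k = ∇_{e_k}` in the unitary frame `e` of `𝔰_J` at each point and `F = dA`,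

  `∫_N (2 Im(conj(∇₀α)∇₁α + conj(∇₂α)∇₃α) + |α|²(F(e₀,e₁) + F(e₂,e₃)))(s ∧ s) = 0`

(`integral_energy_identity_eq_zero`): the integrand is `dθ(e₀,e₁) + dθ(e₂,e₃)` for the smooth 1-form
`θ = Im(ᾱ∇α)` (`GaugeTheory/ConnDerivEnergyIdentity`), i.e. `2 dθ ∧ s / (s ∧ s)`, and `∫ dθ ∧ s = 0`.
Since `|∇₀α + i∇₁α|² - |∇₀α - i∇₁α|² = -4 Im(conj(∇₀α)∇₁α)`, this is the statement that the `∂̄`- and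
`∂`-energies of `α` differ by the curvature term
(`integral_dbar_sub_del_energy_eq`): `∫ ((|∇₀α+i∇₁α|² + |∇₂α+i∇₃α|²) - (|∇₀α-i∇₁α|² + |∇₂α-i∇₃α|²))(s∧s)
= 2 ∫ |α|²(F(e₀,e₁) + F(e₂,e₃))(s∧s)`.

PROVED, 0 named facts.

## References

* M. Hutchings, C. H. Taubes, *An introduction to the Seiberg–Witten equations on symplectic
  manifolds*, IAS/Park City Math. Ser. 7 (1999; AMS 2006), §4.5 (4.14), (4.18). [HutchingsTaubes2006]
* C. H. Taubes, *The Seiberg–Witten and Gromov invariants*, Math. Res. Lett. 2 (1995) 221–238,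
  §5 Step 3 (5.5). [Taubes1995]
-/

noncomputable section

open scoped Manifold ContDiff Topology ComplexConjugate
open Set Function Complex Literature.Geometry.Kaehler Literature.Geometry.GaugeTheory Literature.Topology.FourManifolds
open Literature.Geometry.Lorentzian (PseudoRiemannianMetric)
open Literature.Geometry.Manifold Literature.Geometry.Manifold.DeRhamSignFour Literature.NumberTheory.Transcendental

namespace Literature.Geometry.Symplectic

namespace AlmostComplexStructure.IsCompatibleWith

variable {N : Type} [TopologicalSpace N] [ChartedSpace (EuclideanSpace ℝ (Fin 4)) N] [IsManifold (𝓡 4) ∞ N]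
  {J : AlmostComplexStructure (𝓡 4) ∞ N} {s : MForm (𝓡 4) N ℝ 2}
  (h : J.IsCompatibleWith s) (hs : IsSmoothForm s)
  (hnd : ∀ x (v : TangentSpace (𝓡 4) x), v ≠ 0 → ∃ w : TangentSpace (𝓡 4) x, s x ![v, w] ≠ 0)

omit [IsManifold (𝓡 4) ∞ N] in
/-- Pulling a constant factor out of a function-scaled top form. [folklore] -/
theorem castDeg_const_mul_smul (c : ℝ) (f : N → ℝ) :
    ((fun x ↦ c * f x) • s.wedge s).castDeg two_add_two_eq_four = c • (f • (s.wedge s).castDeg two_add_two_eq_four) := by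
  funext x
  ext w
  simp [mul_assoc]

/-- **The energy identity** on the closed symplectic `4`-manifold: for smooth `α : N → ℂ` and a smooth
real 1-form `A` (connection `∇ = d + iA`, curvature `F = dA`), in the unitary frames of `𝔰_J`,
`∫_N (2 Im(conj(∇₀α)∇₁α + conj(∇₂α)∇₃α) + |α|²(F(e₀,e₁) + F(e₂,e₃)))(s ∧ s) = 0` — the integrand is
`dθ(e₀,e₁) + dθ(e₂,e₃)`, `θ = Im(ᾱ∇α)`, and `∫ dθ ∧ s = 0`. [cite: HutchingsTaubes2006, §4.5 (4.18)]
[cite: Taubes1995, §5 Step 3 (5.5)] -/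
theorem integral_energy_identity_eq_zero [T2Space N] [CompactSpace N] (hcl : IsClosedForm s)
    {α : N → ℂ} (hα : ContMDiff (𝓡 4) 𝓘(ℝ, ℂ) ∞ α) {A : RealOneForm N} (hA : ∀ y, A.SmoothAt y) :
    MForm.integral (rayFamily (wedge_self_castDeg_apply_ne_zero s hnd))
      ((fun x ↦ 2 * ((conj (connDeriv α A x ((h.canonicalSpincStructure hs hnd).frame ((h.canonicalSpincStructure hs hnd).indexAt x) 0 x)) *
              connDeriv α A x ((h.canonicalSpincStructure hs hnd).frame ((h.canonicalSpincStructure hs hnd).indexAt x) 1 x)).im +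
            (conj (connDeriv α A x ((h.canonicalSpincStructure hs hnd).frame ((h.canonicalSpincStructure hs hnd).indexAt x) 2 x)) *
              connDeriv α A x ((h.canonicalSpincStructure hs hnd).frame ((h.canonicalSpincStructure hs hnd).indexAt x) 3 x)).im) +
          Complex.normSq (α x) *
            (mextDeriv A.toMForm x ![(h.canonicalSpincStructure hs hnd).frame ((h.canonicalSpincStructure hs hnd).indexAt x) 0 x,
                (h.canonicalSpincStructure hs hnd).frame ((h.canonicalSpincStructure hs hnd).indexAt x) 1 x] +
              mextDeriv A.toMForm x ![(h.canonicalSpincStructure hs hnd).frame ((h.canonicalSpincStructure hs hnd).indexAt x) 2 x,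
                (h.canonicalSpincStructure hs hnd).frame ((h.canonicalSpincStructure hs hnd).indexAt x) 3 x])) •
        (s.wedge s).castDeg two_add_two_eq_four) = 0 := by
  have hθ : IsSmoothForm (energyForm α A).toMForm := fun x ↦ smoothAt_energyForm hα hA x
  have hint := integral_mextDeriv_toMForm_wedge_eq_zero hs hnd hcl hθ
  have hθ' := h.wedge_symplectic_eq_smul_wedge_self hs hnd (mextDeriv (energyForm α A).toMForm)
  have hframe : ∀ (x : N) (k : Fin 4), ContMDiffAt (𝓡 4) ((𝓡 4).prod 𝓘(ℝ, EuclideanSpace ℝ (Fin 4))) ∞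
      (fun y : N ↦ Bundle.TotalSpace.mk' (EuclideanSpace ℝ (Fin 4)) (E := (TangentSpace (𝓡 4) : N → Type _)) y
        ((h.canonicalSpincStructure hs hnd).frame ((h.canonicalSpincStructure hs hnd).indexAt x) k y)) x := fun x k ↦
    (h.canonicalSpincStructure hs hnd).contMDiffAt_frame _ k ((h.canonicalSpincStructure hs hnd).mem_baseSet_indexAt x)
  have hcoef : (fun x ↦ (mextDeriv (energyForm α A).toMForm x
        ![(h.canonicalSpincStructure hs hnd).frame ((h.canonicalSpincStructure hs hnd).indexAt x) 0 x,
          (h.canonicalSpincStructure hs hnd).frame ((h.canonicalSpincStructure hs hnd).indexAt x) 1 x] +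
      mextDeriv (energyForm α A).toMForm x
        ![(h.canonicalSpincStructure hs hnd).frame ((h.canonicalSpincStructure hs hnd).indexAt x) 2 x,
          (h.canonicalSpincStructure hs hnd).frame ((h.canonicalSpincStructure hs hnd).indexAt x) 3 x]) / 2) =
      fun x ↦ (2⁻¹ : ℝ) * (2 * ((conj (connDeriv α A x ((h.canonicalSpincStructure hs hnd).frame ((h.canonicalSpincStructure hs hnd).indexAt x) 0 x)) *
              connDeriv α A x ((h.canonicalSpincStructure hs hnd).frame ((h.canonicalSpincStructure hs hnd).indexAt x) 1 x)).im +
            (conj (connDeriv α A x ((h.canonicalSpincStructure hs hnd).frame ((h.canonicalSpincStructure hs hnd).indexAt x) 2 x)) *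
              connDeriv α A x ((h.canonicalSpincStructure hs hnd).frame ((h.canonicalSpincStructure hs hnd).indexAt x) 3 x)).im) +
          Complex.normSq (α x) *
            (mextDeriv A.toMForm x ![(h.canonicalSpincStructure hs hnd).frame ((h.canonicalSpincStructure hs hnd).indexAt x) 0 x,
                (h.canonicalSpincStructure hs hnd).frame ((h.canonicalSpincStructure hs hnd).indexAt x) 1 x] +
              mextDeriv A.toMForm x ![(h.canonicalSpincStructure hs hnd).frame ((h.canonicalSpincStructure hs hnd).indexAt x) 2 x,
                (h.canonicalSpincStructure hs hnd).frame ((h.canonicalSpincStructure hs hnd).indexAt x) 3 x])) := by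
    funext x
    rw [mextDeriv_energyForm_apply hα hA (hframe x 0) (hframe x 1), mextDeriv_energyForm_apply hα hA (hframe x 2) (hframe x 3)]
    ring
  rw [hθ', hcoef, castDeg_const_mul_smul, MForm.integral_smul] at hint
  simpa using hint

/-- **The `∂̄`- and `∂`-energies differ by the curvature term** (Hutchings–Taubes (4.18) rearranged):
`∫_N ((|∇₀α+i∇₁α|² + |∇₂α+i∇₃α|²) - (|∇₀α-i∇₁α|² + |∇₂α-i∇₃α|²) - 2|α|²(F(e₀,e₁)+F(e₂,e₃)))(s∧s) = 0`
(`|p + iq|² - |p - iq|² = -4 Im(p̄q)`). [cite: HutchingsTaubes2006, §4.5 (4.18)] -/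
theorem integral_dbar_sub_del_energy_eq_zero [T2Space N] [CompactSpace N] (hcl : IsClosedForm s)
    {α : N → ℂ} (hα : ContMDiff (𝓡 4) 𝓘(ℝ, ℂ) ∞ α) {A : RealOneForm N} (hA : ∀ y, A.SmoothAt y) :
    MForm.integral (rayFamily (wedge_self_castDeg_apply_ne_zero s hnd))
      ((fun x ↦
          (Complex.normSq (connDeriv α A x ((h.canonicalSpincStructure hs hnd).frame ((h.canonicalSpincStructure hs hnd).indexAt x) 0 x) +
                I * connDeriv α A x ((h.canonicalSpincStructure hs hnd).frame ((h.canonicalSpincStructure hs hnd).indexAt x) 1 x)) +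
              Complex.normSq (connDeriv α A x ((h.canonicalSpincStructure hs hnd).frame ((h.canonicalSpincStructure hs hnd).indexAt x) 2 x) +
                I * connDeriv α A x ((h.canonicalSpincStructure hs hnd).frame ((h.canonicalSpincStructure hs hnd).indexAt x) 3 x))) -
            (Complex.normSq (connDeriv α A x ((h.canonicalSpincStructure hs hnd).frame ((h.canonicalSpincStructure hs hnd).indexAt x) 0 x) -
                I * connDeriv α A x ((h.canonicalSpincStructure hs hnd).frame ((h.canonicalSpincStructure hs hnd).indexAt x) 1 x)) +
              Complex.normSq (connDeriv α A x ((h.canonicalSpincStructure hs hnd).frame ((h.canonicalSpincStructure hs hnd).indexAt x) 2 x) -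
                I * connDeriv α A x ((h.canonicalSpincStructure hs hnd).frame ((h.canonicalSpincStructure hs hnd).indexAt x) 3 x))) -
            2 * Complex.normSq (α x) *
              (mextDeriv A.toMForm x ![(h.canonicalSpincStructure hs hnd).frame ((h.canonicalSpincStructure hs hnd).indexAt x) 0 x,
                  (h.canonicalSpincStructure hs hnd).frame ((h.canonicalSpincStructure hs hnd).indexAt x) 1 x] +
                mextDeriv A.toMForm x ![(h.canonicalSpincStructure hs hnd).frame ((h.canonicalSpincStructure hs hnd).indexAt x) 2 x,
                  (h.canonicalSpincStructure hs hnd).frame ((h.canonicalSpincStructure hs hnd).indexAt x) 3 x])) •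
        (s.wedge s).castDeg two_add_two_eq_four) = 0 := by
  have hint := h.integral_energy_identity_eq_zero hs hnd hcl hα hA
  have heq : ∀ x : N,
      (Complex.normSq (connDeriv α A x ((h.canonicalSpincStructure hs hnd).frame ((h.canonicalSpincStructure hs hnd).indexAt x) 0 x) +
                I * connDeriv α A x ((h.canonicalSpincStructure hs hnd).frame ((h.canonicalSpincStructure hs hnd).indexAt x) 1 x)) +
              Complex.normSq (connDeriv α A x ((h.canonicalSpincStructure hs hnd).frame ((h.canonicalSpincStructure hs hnd).indexAt x) 2 x) +
                I * connDeriv α A x ((h.canonicalSpincStructure hs hnd).frame ((h.canonicalSpincStructure hs hnd).indexAt x) 3 x))) -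
            (Complex.normSq (connDeriv α A x ((h.canonicalSpincStructure hs hnd).frame ((h.canonicalSpincStructure hs hnd).indexAt x) 0 x) -
                I * connDeriv α A x ((h.canonicalSpincStructure hs hnd).frame ((h.canonicalSpincStructure hs hnd).indexAt x) 1 x)) +
              Complex.normSq (connDeriv α A x ((h.canonicalSpincStructure hs hnd).frame ((h.canonicalSpincStructure hs hnd).indexAt x) 2 x) -
                I * connDeriv α A x ((h.canonicalSpincStructure hs hnd).frame ((h.canonicalSpincStructure hs hnd).indexAt x) 3 x))) -
            2 * Complex.normSq (α x) *
              (mextDeriv A.toMForm x ![(h.canonicalSpincStructure hs hnd).frame ((h.canonicalSpincStructure hs hnd).indexAt x) 0 x,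
                  (h.canonicalSpincStructure hs hnd).frame ((h.canonicalSpincStructure hs hnd).indexAt x) 1 x] +
                mextDeriv A.toMForm x ![(h.canonicalSpincStructure hs hnd).frame ((h.canonicalSpincStructure hs hnd).indexAt x) 2 x,
                  (h.canonicalSpincStructure hs hnd).frame ((h.canonicalSpincStructure hs hnd).indexAt x) 3 x]) =
      (-2 : ℝ) * (2 * ((conj (connDeriv α A x ((h.canonicalSpincStructure hs hnd).frame ((h.canonicalSpincStructure hs hnd).indexAt x) 0 x)) *
              connDeriv α A x ((h.canonicalSpincStructure hs hnd).frame ((h.canonicalSpincStructure hs hnd).indexAt x) 1 x)).im +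
            (conj (connDeriv α A x ((h.canonicalSpincStructure hs hnd).frame ((h.canonicalSpincStructure hs hnd).indexAt x) 2 x)) *
              connDeriv α A x ((h.canonicalSpincStructure hs hnd).frame ((h.canonicalSpincStructure hs hnd).indexAt x) 3 x)).im) +
          Complex.normSq (α x) *
            (mextDeriv A.toMForm x ![(h.canonicalSpincStructure hs hnd).frame ((h.canonicalSpincStructure hs hnd).indexAt x) 0 x,
                (h.canonicalSpincStructure hs hnd).frame ((h.canonicalSpincStructure hs hnd).indexAt x) 1 x] +
              mextDeriv A.toMForm x ![(h.canonicalSpincStructure hs hnd).frame ((h.canonicalSpincStructure hs hnd).indexAt x) 2 x,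
                (h.canonicalSpincStructure hs hnd).frame ((h.canonicalSpincStructure hs hnd).indexAt x) 3 x])) := by
    intro x
    have h01 := normSq_add_I_mul_sub_normSq_sub_I_mul
      (connDeriv α A x ((h.canonicalSpincStructure hs hnd).frame ((h.canonicalSpincStructure hs hnd).indexAt x) 0 x))
      (connDeriv α A x ((h.canonicalSpincStructure hs hnd).frame ((h.canonicalSpincStructure hs hnd).indexAt x) 1 x))
    have h23 := normSq_add_I_mul_sub_normSq_sub_I_mul
      (connDeriv α A x ((h.canonicalSpincStructure hs hnd).frame ((h.canonicalSpincStructure hs hnd).indexAt x) 2 x))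
      (connDeriv α A x ((h.canonicalSpincStructure hs hnd).frame ((h.canonicalSpincStructure hs hnd).indexAt x) 3 x))
    linear_combination h01 + h23
  have hfun := funext heq
  have hsmul : ((fun x ↦ (-2 : ℝ) * (2 * ((conj (connDeriv α A x ((h.canonicalSpincStructure hs hnd).frame ((h.canonicalSpincStructure hs hnd).indexAt x) 0 x)) *
              connDeriv α A x ((h.canonicalSpincStructure hs hnd).frame ((h.canonicalSpincStructure hs hnd).indexAt x) 1 x)).im +
            (conj (connDeriv α A x ((h.canonicalSpincStructure hs hnd).frame ((h.canonicalSpincStructure hs hnd).indexAt x) 2 x)) *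
              connDeriv α A x ((h.canonicalSpincStructure hs hnd).frame ((h.canonicalSpincStructure hs hnd).indexAt x) 3 x)).im) +
          Complex.normSq (α x) *
            (mextDeriv A.toMForm x ![(h.canonicalSpincStructure hs hnd).frame ((h.canonicalSpincStructure hs hnd).indexAt x) 0 x,
                (h.canonicalSpincStructure hs hnd).frame ((h.canonicalSpincStructure hs hnd).indexAt x) 1 x] +
              mextDeriv A.toMForm x ![(h.canonicalSpincStructure hs hnd).frame ((h.canonicalSpincStructure hs hnd).indexAt x) 2 x,
                (h.canonicalSpincStructure hs hnd).frame ((h.canonicalSpincStructure hs hnd).indexAt x) 3 x]))) •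
        (s.wedge s).castDeg two_add_two_eq_four : MForm (𝓡 4) N ℝ 4) =
      (-2 : ℝ) • ((fun x ↦ 2 * ((conj (connDeriv α A x ((h.canonicalSpincStructure hs hnd).frame ((h.canonicalSpincStructure hs hnd).indexAt x) 0 x)) *
              connDeriv α A x ((h.canonicalSpincStructure hs hnd).frame ((h.canonicalSpincStructure hs hnd).indexAt x) 1 x)).im +
            (conj (connDeriv α A x ((h.canonicalSpincStructure hs hnd).frame ((h.canonicalSpincStructure hs hnd).indexAt x) 2 x)) *
              connDeriv α A x ((h.canonicalSpincStructure hs hnd).frame ((h.canonicalSpincStructure hs hnd).indexAt x) 3 x)).im) +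
          Complex.normSq (α x) *
            (mextDeriv A.toMForm x ![(h.canonicalSpincStructure hs hnd).frame ((h.canonicalSpincStructure hs hnd).indexAt x) 0 x,
                (h.canonicalSpincStructure hs hnd).frame ((h.canonicalSpincStructure hs hnd).indexAt x) 1 x] +
              mextDeriv A.toMForm x ![(h.canonicalSpincStructure hs hnd).frame ((h.canonicalSpincStructure hs hnd).indexAt x) 2 x,
                (h.canonicalSpincStructure hs hnd).frame ((h.canonicalSpincStructure hs hnd).indexAt x) 3 x])) •
        (s.wedge s).castDeg two_add_two_eq_four) := by
    funext x
    ext w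
    simp [mul_assoc]
  rw [hfun, hsmul, MForm.integral_smul, hint, mul_zero]

end AlmostComplexStructure.IsCompatibleWith

end Literature.Geometry.Symplectic

end
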